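import Mathlib
import HarnessLib
import Literature.Analysis.FluidPDE.ClassicalSolution
import Literature.Analysis.FluidPDE.Vorticity
import Summits.NavierStokesRegularity.NavierStokesRegularity.Theorems.QuarterLogPincerBeadCensusDefs
import Summits.NavierStokesRegularity.NavierStokesRegularity.Theorems.QuarterLogPincerBeadCensusKernel
import Summits.NavierStokesRegularity.NavierStokesRegularity.Theorems.QuarterLogPincerCubicRungDefs
import Summits.NavierStokesRegularity.NavierStokesRegularity.Theorems.QuarterLogPincerFlatChainDefs

/-!
# Route `QuarterLogPincer`, crux `TypeIQuantSubcubicExp` (stmt-NavierStokesRegularity-24077), line `flat_chain` —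
# the line's sorry-free KERNEL, verbatim (composition theorems)

VERBATIM port of the sorry-free kernel of ns-idea-7 g14's workfile `Cruxes/TypeIQuantSubcubicExp/Lines/flat_chain.lean`
(v1.6; idea-crit-4 verdicts of record flat_chain PASS A−, slice_census PASS B+), over the objects home
`Theorems/QuarterLogPincerFlatChainDefs.lean` (parts 1–2), namespace `…Cruxes.TypeIQuantSubcubicExp.FlatChain`:
`levelScale_pos_le`, `exists_mu_ratio`, the good-level accounting `chainAt_of_goodDepositAt`, the G2♭ composition
`bpChainRateFlat_of_conc : LevelConcentration → TypeIEpoch → GoodLevelTransfer → BPChainRateFlat` (+ the v1 signature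
`bpChainRateFlat_of`), the rung edge `typeIQuantCubicExp_of_beadCensus_of_conc : BeadCensus → LevelConcentration → TypeIEpoch →
GoodLevelTransfer → TypeIQuantCubicExp` (R0-rate rung `CubicRung.TypeIQuantCubicExp` BY NAME), and the §8 slice-census kernel
`card_mul_le_cube_of_deposits`, `quantCubicExpAt_of_dichotomy`, `typeIQuantCubicExp_of_sliceCensus_conc : SliceCensus →
LightSliceRegular → LevelConcentration → TypeIEpoch → RegularBlockTransfer → TypeIQuantCubicExp` (+ the v1.1 signature
`typeIQuantCubicExp_of_sliceCensus`).  The stub-plugged variants (`…_of_stubs`) are NOT ported (they mention the line's sorries);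
the closers with the LANDED stubs S3/S4′ plugged in live in `…FlatChainAssembly`.  Proof texts by ns-idea-7 (g14), unchanged
(only textual change: the unused binder `hc` of `chainAt_of_goodDepositAt` is spelled `_hc`, 0-warning rule).
HONEST FRAME: implications between OPEN statements about HYPOTHETICAL Type-I classical solutions; nothing here bears on 24077's
truth, W7 or Navier–Stokes regularity (OPEN / not proved).  pub-ns-dss typer (g39), `--supports stmt-NavierStokesRegularity-24077`.
-/

set_option linter.dupNamespace false

noncomputable section

open MeasureTheory Set Metric
open scoped ENNReal NNReal Classical
open Literature.Analysis Literature.Analysis.FluidPDE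
open Summit.NavierStokesRegularity.NavierStokesRegularity.Cruxes.TypeIQuantSubcubicExp.BeadCensus
open Summit.NavierStokesRegularity.NavierStokesRegularity.Cruxes.TypeIQuantSubcubicExp.CubicRung

namespace Summit.NavierStokesRegularity.NavierStokesRegularity.Cruxes.TypeIQuantSubcubicExp.FlatChain

/-! ## Kernel of LINE g14-1: S1 → S3 → S4 → G2♭ → rung -/

/-- Level scales are positive and at most `t₁` (`a ≥ 0`). -/
theorem levelScale_pos_le {a t₁ : ℝ} (ha : 0 ≤ a) (ht₁ : 0 < t₁) (j : ℕ) :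
    0 < levelScale a t₁ j ∧ levelScale a t₁ j ≤ t₁ := by
  unfold levelScale
  refine ⟨mul_pos ht₁ (Real.exp_pos _), ?_⟩
  have h1 : Real.exp (-2 * a * j) ≤ 1 := by
    rw [Real.exp_le_one_iff]
    have : (0 : ℝ) ≤ j := Nat.cast_nonneg j
    nlinarith
  calc t₁ * Real.exp (-2 * a * j) ≤ t₁ * 1 := mul_le_mul_of_nonneg_left h1 ht₁.le
    _ = t₁ := mul_one _

/-- For `M ≥ 2` every ratio threshold `Λ₁ ≥ 1` is met by some annulus exponent `μ > 0`: `Λ₁ ≤ M^{10μ}`. -/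
theorem exists_mu_ratio {M Λ₁ : ℝ} (hM : 2 ≤ M) (hΛ₁ : 1 ≤ Λ₁) :
    ∃ μ : ℝ, 0 < μ ∧ Λ₁ ≤ M ^ (10 * μ) := by
  have hMpos : 0 < M := by linarith
  have hlogM : 0 < Real.log M := Real.log_pos (by linarith)
  have hlogΛ : 0 ≤ Real.log Λ₁ := Real.log_nonneg hΛ₁
  refine ⟨Real.log Λ₁ / (10 * Real.log M) + 1, by positivity, ?_⟩
  rw [Real.rpow_def_of_pos hMpos]
  calc Λ₁ = Real.exp (Real.log Λ₁) := (Real.exp_log (by linarith)).symm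
    _ ≤ Real.exp (Real.log M * (10 * (Real.log Λ₁ / (10 * Real.log M) + 1))) := by
        apply Real.exp_le_exp.2
        have e : Real.log M * (10 * (Real.log Λ₁ / (10 * Real.log M) + 1)) =
            Real.log Λ₁ + 10 * Real.log M := by
          have h10 : 10 * Real.log M ≠ 0 := by positivity
          calc Real.log M * (10 * (Real.log Λ₁ / (10 * Real.log M) + 1))
              = Real.log Λ₁ * (10 * Real.log M) / (10 * Real.log M) + 10 * Real.log M := by ring
            _ = Real.log Λ₁ + 10 * Real.log M := by rw [mul_div_cancel_right₀ _ h10]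
        rw [e]
        linarith

/-- **The accounting for good levels** (mirror of `censusAt_of_flarePersistenceAt`): good shells are pairwise
disjoint, each holds `≥ c`, the slice holds `≤ A³`; hence `#good · c ≤ A³`, i.e. `ChainAt M μ a 0 c`. -/
theorem chainAt_of_goodDepositAt {M μ a c : ℝ} (hM : 1 ≤ M) (ha : 0 ≤ a) (_hc : 0 < c)
    (h : GoodDepositAt M μ a c) : ChainAt M μ a 0 c := by
  intro T τ A t₁ x₀ u p n hframe hτ hrate hL3 hA ht₁ hviol
  have hviol' : Real.exp (a * (n + 1)) ≤ ‖u t₁ x₀‖ * Real.sqrt t₁ := by simpa using hviol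
  set G := (Finset.range n).filter fun k => GoodLevel M μ a u t₁ x₀ (k + 1) with hG
  have hA0 : 0 ≤ A := by linarith
  -- the slice's cube mass
  have hI : ∫⁻ x, ‖u t₁ x‖ₑ ^ (3 : ℝ) ≤ ENNReal.ofReal (A ^ 3) := by
    have hL := hL3 t₁ ⟨ht₁.1.le, ht₁.2⟩
    rw [eLpNorm_eq_lintegral_rpow_enorm_toReal (by norm_num) (by norm_num)] at hL
    simp only [ENNReal.toReal_ofNat] at hL
    have h3 := ENNReal.rpow_le_rpow hL (by norm_num : (0 : ℝ) ≤ 3)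
    rw [← ENNReal.rpow_mul, show (1 / 3 : ℝ) * 3 = 1 by norm_num, ENNReal.rpow_one,
      ENNReal.ofReal_rpow_of_nonneg hA0 (by norm_num : (0 : ℝ) ≤ 3)] at h3
    have hA3 : A ^ (3 : ℝ) = A ^ 3 := by
      rw [show (3 : ℝ) = ((3 : ℕ) : ℝ) by norm_num, Real.rpow_natCast]
    rwa [hA3] at h3
  -- each good level deposits ≥ c into its own shell
  have hdep : ∀ k ∈ G, ENNReal.ofReal c ≤
      ∫⁻ x in levelShell M a t₁ x₀ (k + 1), ‖u t₁ x‖ₑ ^ (3 : ℝ) := by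
    intro k hk
    have hk' := Finset.mem_filter.1 hk
    exact h T τ t₁ x₀ u p n hframe hτ hrate ht₁ hviol' k (Finset.mem_range.1 hk'.1) hk'.2
  -- the shells of distinct levels are disjoint
  have hdisj : Set.PairwiseDisjoint (↑G : Set ℕ) (fun k => levelShell M a t₁ x₀ (k + 1)) := by
    intro i _ j _ hne
    change Disjoint (levelShell M a t₁ x₀ (i + 1)) (levelShell M a t₁ x₀ (j + 1))
    have hM4 : 1 / 4 ≤ M := by linarith
    rcases Nat.lt_or_gt_of_ne hne with hlt | hgt
    · exact levelShell_disjoint hM4 ha x₀ (Nat.succ_lt_succ hlt)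
    · exact (levelShell_disjoint hM4 ha x₀ (Nat.succ_lt_succ hgt)).symm
  -- sum
  have hsum : (G.card : ℝ≥0∞) * ENNReal.ofReal c ≤ ENNReal.ofReal (A ^ 3) := by
    calc (G.card : ℝ≥0∞) * ENNReal.ofReal c
        = ∑ k ∈ G, ENNReal.ofReal c := by simp [Finset.sum_const, nsmul_eq_mul]
      _ ≤ ∑ k ∈ G, ∫⁻ x in levelShell M a t₁ x₀ (k + 1), ‖u t₁ x‖ₑ ^ (3 : ℝ) :=
          Finset.sum_le_sum hdep
      _ = ∫⁻ x in ⋃ k ∈ G, levelShell M a t₁ x₀ (k + 1), ‖u t₁ x‖ₑ ^ (3 : ℝ) :=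
          (lintegral_biUnion_finset hdisj (fun k _ => measurableSet_levelShell M a t₁ x₀ (k + 1)) _).symm
      _ ≤ ∫⁻ x, ‖u t₁ x‖ₑ ^ (3 : ℝ) := setLIntegral_le_lintegral _ _
      _ ≤ ENNReal.ofReal (A ^ 3) := hI
  -- back to reals
  have hA3 : 0 ≤ A ^ 3 := by positivity
  have h' : ENNReal.ofReal ((G.card : ℝ) * c) ≤ ENNReal.ofReal (A ^ 3) := by
    rwa [ENNReal.ofReal_mul (Nat.cast_nonneg _), ENNReal.ofReal_natCast]
  exact (ENNReal.ofReal_le_ofReal_iff hA3).1 h'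

/-- **Kernel `bpChainRateFlat_of` (sorry-free): S2 → (S2 → S1) → S3 → S4 → G2♭.**  Given `M ≥ 2`: constants
`ρ, η` (S1), `Ce` (S3), then `Λ₁, D` (S4), then `μ` with `M^{10μ} ≥ Λ₁`, then `a₁(M,D)` (S1); for `a ≥ a₁` the deposit
`c` (S4); every good level `k < n` receives its epoch block (S3, `s_{k+1} ≤ t₁`) and its concentration block (S1), hence
deposits `c` (S4); the accounting closes `ChainAt M μ a 0 c`. -/
theorem bpChainRateFlat_of_conc (hconc : LevelConcentration)
    (h₃ : TypeIEpoch) (h₄ : GoodLevelTransfer) : BPChainRateFlat := by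
  refine ⟨2, by norm_num, fun M hM => ?_⟩
  have hM1 : (1 : ℝ) ≤ M := by linarith
  obtain ⟨ρ, η, hρ, hη, hS1⟩ := hconc M
  obtain ⟨Ce, hCe, hS3⟩ := h₃ M
  obtain ⟨Λ₁, D, hΛ₁, hD, hS4⟩ := h₄ M Ce ρ η hM1 hCe hρ hη
  obtain ⟨μ, hμ, hΛμ⟩ := exists_mu_ratio hM hΛ₁
  obtain ⟨a₁, ha₁, hS1'⟩ := hS1 D hD
  refine ⟨μ, 0, a₁, hμ, le_rfl, ha₁, fun a ha => ?_⟩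
  have ha0 : 0 ≤ a := ha₁.le.trans ha
  obtain ⟨c, hc, hdep⟩ := hS4 μ a hμ hΛμ ha0
  refine ⟨c, hc, chainAt_of_goodDepositAt hM1 ha0 hc ?_⟩
  intro T τ t₁ x₀ u p n hframe hτ hrate ht₁ hviol k hk hgood
  have hs := levelScale_pos_le ha0 ht₁.1 (k + 1)
  exact hdep T t₁ x₀ u p k hframe ht₁ hgood
    (hS3 D hD T τ t₁ (levelScale a t₁ (k + 1)) u p hframe hτ hrate ht₁ hs.1 hs.2)
    (hS1' a ha T τ t₁ x₀ u p n hframe hτ hrate ht₁ hviol k hk)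

/-- v1/v1.1 signature (S2 → (S2 → S1) → S3 → S4 → G2♭), now a corollary of `bpChainRateFlat_of_conc`. -/
theorem bpChainRateFlat_of (h₂ : LocalSmoothingL6) (h₁ : LocalSmoothingL6 → LevelConcentration)
    (h₃ : TypeIEpoch) (h₄ : GoodLevelTransfer) : BPChainRateFlat :=
  bpChainRateFlat_of_conc (h₁ h₂) h₃ h₄

/-- G2♭ route to the rung from the census G1♯-chain `BeadCensus`, S1 (any provenance), S3, S4 (v1.2). -/
theorem typeIQuantCubicExp_of_beadCensus_of_conc (hcensus : BeadCensus) (hconc : LevelConcentration)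
    (h₃ : TypeIEpoch) (h₄ : GoodLevelTransfer) : TypeIQuantCubicExp :=
  typeIQuantCubicExp_of_beadCensus_of_bpChainRateFlat hcensus (bpChainRateFlat_of_conc hconc h₃ h₄)

/-! ## §8 Kernel of LINE g14-2: `SliceCensus → β → S1 → S3 → S4′ → rung` -/

/-- **Disjoint-shell accounting** for an arbitrary finite set `G` of levels: if every `k ∈ G` holds `≥ c` of cube mass
at `t₁` in `levelShell (k+1)` and the slice has `‖u(t₁)‖₃ ≤ A`, then `#G · c ≤ A³` (`levelShell_disjoint` +
`lintegral_biUnion_finset`). -/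
theorem card_mul_le_cube_of_deposits {M a c A t₁ : ℝ} {x₀ : EuclideanSpace ℝ (Fin 3)}
    {u : ℝ → EuclideanSpace ℝ (Fin 3) → EuclideanSpace ℝ (Fin 3)} (hM : 1 ≤ M) (ha : 0 ≤ a) (hA : 0 ≤ A)
    (G : Finset ℕ)
    (hdep : ∀ k ∈ G, ENNReal.ofReal c ≤ ∫⁻ x in levelShell M a t₁ x₀ (k + 1), ‖u t₁ x‖ₑ ^ (3 : ℝ))
    (hL3 : eLpNorm (u t₁) 3 volume ≤ ENNReal.ofReal A) : (G.card : ℝ) * c ≤ A ^ 3 := by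
  -- the slice's cube mass
  have hI : ∫⁻ x, ‖u t₁ x‖ₑ ^ (3 : ℝ) ≤ ENNReal.ofReal (A ^ 3) := by
    have hL := hL3
    rw [eLpNorm_eq_lintegral_rpow_enorm_toReal (by norm_num) (by norm_num)] at hL
    simp only [ENNReal.toReal_ofNat] at hL
    have h3 := ENNReal.rpow_le_rpow hL (by norm_num : (0 : ℝ) ≤ 3)
    rw [← ENNReal.rpow_mul, show (1 / 3 : ℝ) * 3 = 1 by norm_num, ENNReal.rpow_one,
      ENNReal.ofReal_rpow_of_nonneg hA (by norm_num : (0 : ℝ) ≤ 3)] at h3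
    have hA3 : A ^ (3 : ℝ) = A ^ 3 := by
      rw [show (3 : ℝ) = ((3 : ℕ) : ℝ) by norm_num, Real.rpow_natCast]
    rwa [hA3] at h3
  -- the shells of distinct levels are disjoint
  have hdisj : Set.PairwiseDisjoint (↑G : Set ℕ) (fun k => levelShell M a t₁ x₀ (k + 1)) := by
    intro i _ j _ hne
    change Disjoint (levelShell M a t₁ x₀ (i + 1)) (levelShell M a t₁ x₀ (j + 1))
    have hM4 : 1 / 4 ≤ M := by linarith
    rcases Nat.lt_or_gt_of_ne hne with hlt | hgt
    · exact levelShell_disjoint hM4 ha x₀ (Nat.succ_lt_succ hlt)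
    · exact (levelShell_disjoint hM4 ha x₀ (Nat.succ_lt_succ hgt)).symm
  -- sum
  have hsum : (G.card : ℝ≥0∞) * ENNReal.ofReal c ≤ ENNReal.ofReal (A ^ 3) := by
    calc (G.card : ℝ≥0∞) * ENNReal.ofReal c
        = ∑ k ∈ G, ENNReal.ofReal c := by simp [Finset.sum_const, nsmul_eq_mul]
      _ ≤ ∑ k ∈ G, ∫⁻ x in levelShell M a t₁ x₀ (k + 1), ‖u t₁ x‖ₑ ^ (3 : ℝ) :=
          Finset.sum_le_sum hdep
      _ = ∫⁻ x in ⋃ k ∈ G, levelShell M a t₁ x₀ (k + 1), ‖u t₁ x‖ₑ ^ (3 : ℝ) :=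
          (lintegral_biUnion_finset hdisj (fun k _ => measurableSet_levelShell M a t₁ x₀ (k + 1)) _).symm
      _ ≤ ∫⁻ x, ‖u t₁ x‖ₑ ^ (3 : ℝ) := setLIntegral_le_lintegral _ _
      _ ≤ ENNReal.ofReal (A ^ 3) := hI
  -- back to reals
  have hA3 : 0 ≤ A ^ 3 := by positivity
  have h' : ENNReal.ofReal ((G.card : ℝ) * c) ≤ ENNReal.ofReal (A ^ 3) := by
    rwa [ENNReal.ofReal_mul (Nat.cast_nonneg _), ENNReal.ofReal_natCast]
  exact (ENNReal.ofReal_le_ofReal_iff hA3).1 h'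

/-- **Counting to the rung, for an ARBITRARY dichotomy of levels** (the `b = 0` form of
`BeadCensus.quantCubicExpAt_of_censusAt_of_chainAt` with `GoodLevel` replaced by the negation of any level predicate
`P`): if under every violator of `n` levels the non-`P` levels satisfy `#·c ≤ A³` and the `P` levels number `≤ C·A³`,
then `log F_M(A) ≤ K A³` with `K := a(1/c + C⁺ + 2)`. -/
theorem quantCubicExpAt_of_dichotomy {M a c C : ℝ} (ha : 0 < a) (hc : 0 < c)
    (P : (ℝ → EuclideanSpace ℝ (Fin 3) → EuclideanSpace ℝ (Fin 3)) → ℝ → EuclideanSpace ℝ (Fin 3) → ℕ → Prop)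
    (hgood : ∀ (T τ A t₁ : ℝ) (x₀ : EuclideanSpace ℝ (Fin 3))
        (u : ℝ → EuclideanSpace ℝ (Fin 3) → EuclideanSpace ℝ (Fin 3)) (p : ℝ → EuclideanSpace ℝ (Fin 3) → ℝ)
        (n : ℕ),
        (IsClassicalNSSolutionOn (Icc 0 T) 1 0 u p ∧
            ∀ m : ℕ, ∃ C : NNReal, ∀ t ∈ Icc 0 T, eLpNorm (iteratedFDeriv ℝ m (u t)) 2 volume ≤ C) →
          0 < τ →
          (∀ t ∈ Icc 0 T, ∀ x : EuclideanSpace ℝ (Fin 3), ‖u t x‖ ≤ M * (T + τ - t) ^ (-(1 / 2 : ℝ))) →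
          (∀ t ∈ Icc 0 T, eLpNorm (u t) 3 volume ≤ ENNReal.ofReal A) → 2 ≤ A →
          t₁ ∈ Ioc 0 T → Real.exp (a * (n + 1)) ≤ ‖u t₁ x₀‖ * Real.sqrt t₁ →
          (((Finset.range n).filter fun k => ¬ P u t₁ x₀ (k + 1)).card : ℝ) * c ≤ A ^ 3)
    (hbad : ∀ (T τ A t₁ : ℝ) (x₀ : EuclideanSpace ℝ (Fin 3))
        (u : ℝ → EuclideanSpace ℝ (Fin 3) → EuclideanSpace ℝ (Fin 3)) (p : ℝ → EuclideanSpace ℝ (Fin 3) → ℝ)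
        (n : ℕ),
        (IsClassicalNSSolutionOn (Icc 0 T) 1 0 u p ∧
            ∀ m : ℕ, ∃ C : NNReal, ∀ t ∈ Icc 0 T, eLpNorm (iteratedFDeriv ℝ m (u t)) 2 volume ≤ C) →
          0 < τ →
          (∀ t ∈ Icc 0 T, ∀ x : EuclideanSpace ℝ (Fin 3), ‖u t x‖ ≤ M * (T + τ - t) ^ (-(1 / 2 : ℝ))) →
          (∀ t ∈ Icc 0 T, eLpNorm (u t) 3 volume ≤ ENNReal.ofReal A) → 2 ≤ A →
          t₁ ∈ Ioc 0 T → Real.exp (a * (n + 1)) ≤ ‖u t₁ x₀‖ * Real.sqrt t₁ →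
          (((Finset.range n).filter fun k => P u t₁ x₀ (k + 1)).card : ℝ) ≤ C * A ^ 3) :
    QuantCubicExpAt M := by
  set C' : ℝ := max C 0 with hC'
  have hC'0 : 0 ≤ C' := le_max_right _ _
  refine ⟨a * (1 / c + C' + 2), ?_⟩
  intro T τ A u p hframe hτ htypeI hL3 hA t ht x
  by_contra hviol
  push Not at hviol
  have hA0 : 0 < A := by linarith
  have hA3 : 8 ≤ A ^ 3 := by
    calc (8 : ℝ) = 2 ^ 3 := by norm_num
      _ ≤ A ^ 3 := by gcongr
  -- the violator in `√t` form
  have ht0 : 0 < t := ht.1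
  have hsqrt : 0 < Real.sqrt t := Real.sqrt_pos.2 ht0
  have hviol' : Real.exp ((a * (1 / c + C' + 2)) * A ^ 3) < ‖u t x‖ * Real.sqrt t := by
    have e : t ^ (-(1 / 2 : ℝ)) = (Real.sqrt t)⁻¹ := by
      rw [Real.rpow_neg ht0.le, ← Real.sqrt_eq_rpow]
    rw [e, ← div_eq_mul_inv, div_lt_iff₀ hsqrt] at hviol
    exact hviol
  -- depth `n := ⌊L⌋₊ - 1`, `L := (1/c + C' + 2) A³`, so that `a (n+1) ≤ K A³`
  set L : ℝ := (1 / c + C' + 2) * A ^ 3 with hL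
  have hL1 : 2 ≤ L := by
    have : (0 : ℝ) ≤ 1 / c + C' := by positivity
    nlinarith
  set n : ℕ := ⌊L⌋₊ - 1 with hn
  have hfloor1 : 1 ≤ ⌊L⌋₊ := Nat.one_le_iff_ne_zero.2 (by
    intro h0
    have := (Nat.floor_eq_zero.1 h0)
    linarith)
  have hn_real : (n : ℝ) = (⌊L⌋₊ : ℝ) - 1 := by
    rw [hn, Nat.cast_sub hfloor1, Nat.cast_one]
  have hn_le : ((n : ℝ) + 1) ≤ L := by
    rw [hn_real]
    have := Nat.floor_le (by linarith : (0 : ℝ) ≤ L)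
    linarith
  have hn_ge : L - 2 ≤ (n : ℝ) := by
    rw [hn_real]
    have := Nat.lt_floor_add_one L
    linarith
  have hexp : Real.exp (a * (n + 1)) ≤ ‖u t x‖ * Real.sqrt t := by
    refine le_trans (Real.exp_le_exp.2 ?_) hviol'.le
    have h1 : a * ((n : ℝ) + 1) ≤ a * L := mul_le_mul_of_nonneg_left hn_le ha.le
    have e : (a * (1 / c + C' + 2)) * A ^ 3 = a * L := by rw [hL]; ring
    linarith
  -- the two halves of the dichotomy
  have hg := hgood T τ A t x u p n hframe hτ htypeI hL3 hA ht hexp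
  have hb' : (((Finset.range n).filter fun k => P u t x (k + 1)).card : ℝ) ≤ C' * A ^ 3 :=
    (hbad T τ A t x u p n hframe hτ htypeI hL3 hA ht hexp).trans
      (mul_le_mul_of_nonneg_right (le_max_left _ _) (by positivity))
  have hsplit : (((Finset.range n).filter fun k => P u t x (k + 1)).card : ℝ) +
      (((Finset.range n).filter fun k => ¬ P u t x (k + 1)).card : ℝ) = n := by
    have h := Finset.card_filter_add_card_filter_not (s := Finset.range n) (fun k => P u t x (k + 1))
    rw [Finset.card_range] at h
    exact_mod_cast h
  have hgood_le : (((Finset.range n).filter fun k => ¬ P u t x (k + 1)).card : ℝ) ≤ A ^ 3 / c := by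
    rw [le_div_iff₀ hc]
    exact hg
  have h1 : (n : ℝ) ≤ A ^ 3 / c + C' * A ^ 3 := by linarith
  have h2 : A ^ 3 / c + C' * A ^ 3 + 14 ≤ (n : ℝ) := by
    have e : L = A ^ 3 / c + C' * A ^ 3 + 2 * A ^ 3 := by rw [hL]; ring
    linarith
  linarith

/-- **Kernel of LINE g14-2 (sorry-free):** `SliceCensus → β → S2 → (S2 → S1) → S3 → S4′ → TypeIQuantCubicExp`.
Given `M`, work at `M' := max M 2`: constants `Cg, γ, ϑ, a₂` (β), `ρ, η` (S1), `Ce` (S3), then `Λ₁, D` (S4′ at `Cg`),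
then `a₁(D)` (S1) and `a₀(M',γ,ϑ,Λ₁)` (census); at `a := max a₀ a₁ a₂` the deposit `c` (S4′) and the census constant `C`.
Dichotomy of the levels `k < n` under a violator: a NON-heavy slice has an admissible light block, hence (β) a regular
block of ratio `Λ₁`, hence — with its epoch block (S3) and concentration block (S1) — a deposit `c` in its own shell at
`t₁` (S4′); disjoint shells give `#non-heavy · c ≤ A³`; heavy slices are `≤ C·A³` (census).  `quantCubicExpAt_of_dichotomy`
closes `QuantCubicExpAt M'`, and antitonicity in the Type-I constant gives `QuantCubicExpAt M`. -/
theorem typeIQuantCubicExp_of_sliceCensus_conc (hcen : SliceCensus) (hβ : LightSliceRegular)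
    (hconc : LevelConcentration) (h₃ : TypeIEpoch) (h₄ : RegularBlockTransfer) :
    TypeIQuantCubicExp := by
  intro M
  obtain ⟨M', hMM', hM'2⟩ : ∃ M' : ℝ, M ≤ M' ∧ 2 ≤ M' := ⟨max M 2, le_max_left _ _, le_max_right _ _⟩
  have hM'1 : (1 : ℝ) ≤ M' := by linarith
  obtain ⟨Cg, γ, ϑ, a₂, hCg, hγ, hϑ, ha₂, Hβ⟩ := hβ M' hM'1
  obtain ⟨ρ, η, hρ, hη, hS1⟩ := hconc M'
  obtain ⟨Ce, hCe, hS3⟩ := h₃ M'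
  obtain ⟨Λ₁, D, hΛ₁, hD, hS4⟩ := h₄ M' Ce ρ η Cg hM'1 hCe hρ hη hCg
  obtain ⟨a₁, ha₁, hS1'⟩ := hS1 D hD
  obtain ⟨a₀, Hcen⟩ := hcen M' γ ϑ Λ₁ hM'1 hγ hϑ hΛ₁
  obtain ⟨a, h0a, h1a, h2a, hapos⟩ : ∃ a : ℝ, a₀ ≤ a ∧ a₁ ≤ a ∧ a₂ ≤ a ∧ 0 < a :=
    ⟨max (max a₀ a₁) a₂, (le_max_left _ _).trans (le_max_left _ _),
      (le_max_right _ _).trans (le_max_left _ _), le_max_right _ _, lt_of_lt_of_le ha₂ (le_max_right _ _)⟩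
  obtain ⟨c, hc, hdep⟩ := hS4 a hapos.le
  obtain ⟨C, HC⟩ := Hcen a h0a
  refine quantCubicExpAt_antitone hMM'
    (quantCubicExpAt_of_dichotomy (C := C) hapos hc (fun u t₁ x₀ k => HeavySlice M' γ ϑ Λ₁ a u t₁ x₀ k) ?_ ?_)
  · -- non-heavy levels deposit `c` into their own (disjoint) shells
    intro T τ A t₁ x₀ u p n hframe hτ hrate hL3 hA ht₁ hviol
    refine card_mul_le_cube_of_deposits (x₀ := x₀) hM'1 hapos.le (by linarith) _ (fun k hk => ?_)
      (hL3 t₁ ⟨ht₁.1.le, ht₁.2⟩)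
    obtain ⟨hkn, hnot⟩ := Finset.mem_filter.1 hk
    have hkn' : k < n := Finset.mem_range.1 hkn
    have hlight : ∃ ρ' : ℝ, 4 * M' ≤ ρ' ∧ ϑ ≤ ρ' ∧ 4 * Λ₁ * ρ' ≤ Real.exp a ∧
        LightBlock γ ϑ (4 * Λ₁) a u t₁ x₀ (k + 1) ρ' := by
      by_contra hcon
      push Not at hcon
      exact hnot fun ρ' h1 h2 h3 => hcon ρ' h1 h2 h3
    obtain ⟨ρ', hρ'M, hρ'ϑ, hρ'a, hLB⟩ := hlight
    have hreg : RegularBlock Cg Λ₁ M' a u t₁ x₀ (k + 1) :=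
      Hβ Λ₁ a hΛ₁ h2a T τ t₁ x₀ u p k ρ' hframe hτ hrate ht₁ hρ'M hρ'ϑ hρ'a hLB
    have hs := levelScale_pos_le hapos.le ht₁.1 (k + 1)
    exact hdep T t₁ x₀ u p k hframe ht₁ hreg
      (hS3 D hD T τ t₁ (levelScale a t₁ (k + 1)) u p hframe hτ hrate ht₁ hs.1 hs.2)
      (hS1' a h1a T τ t₁ x₀ u p n hframe hτ hrate ht₁ hviol k hkn')
  · -- heavy levels are counted by the census
    intro T τ A t₁ x₀ u p n hframe hτ hrate hL3 hA ht₁ hviol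
    exact HC T τ A t₁ x₀ u p n hframe hτ hrate hL3 hA ht₁ hviol

/-- v1.1 signature of the LINE g14-2 kernel (with S2), now a corollary of `typeIQuantCubicExp_of_sliceCensus_conc`. -/
theorem typeIQuantCubicExp_of_sliceCensus (hcen : SliceCensus) (hβ : LightSliceRegular) (h₂ : LocalSmoothingL6)
    (h₁ : LocalSmoothingL6 → LevelConcentration) (h₃ : TypeIEpoch) (h₄ : RegularBlockTransfer) :
    TypeIQuantCubicExp :=
  typeIQuantCubicExp_of_sliceCensus_conc hcen hβ (h₁ h₂) h₃ h₄

end Summit.NavierStokesRegularity.NavierStokesRegularity.Cruxes.TypeIQuantSubcubicExp.FlatChain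

end
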